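import Mathlib
import Summits.Ventures.PercRepro2.Tail2D
import Summits.Ventures.PercRepro2.Tail2DExchange
import Summits.Ventures.PercRepro2.Tail2DThreePoint
import Summits.Ventures.PercRepro2.Tail2DPairSign
import Summits.Ventures.PercRepro2.Tail2DFlowTwoLemmas

/-!
# The transport step of the six-point convolution, part 1: absorption by several absorbers and the
new pairwise absorption lemmas (seat mine-b, cell pub-perc-repro2)

The flow-two step (Tail2DFlowTwo.lean) pays for each unsigned pair coefficient of the exchange defects of
the six-point convolution by ONE inner pair, through one of six minor inequalities on the weights.  Wide
series–parallel laws such as `(e∗e) ∧ P(e^d)` (`d ≥ 4`) violate the level minor `n₁₀ n₀₁ ≥ n₁₁ n₀₀` while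
their tails are M♮ on the census (conjectures/MINE-B.md §32.6, §33).  The transport step pays for an
unsigned pair by SEVERAL absorbers at once: the weight of the outer pair is split among inner pairs whose
absorption lemmas hold (`absorb_two`, `absorb_split`), so that the hypotheses on the weights become
transport (Hall-type) conditions instead of single minors.

This file holds the arithmetic of the split and the new absorption lemmas of the tail `T`:
`abs1_N1` (the `m1` pair `{(2,0),(0,0)}` absorbed into `{(1,0),(1,1)}`) and its mirror `abs1_N1'`
(`{(0,2),(0,0)}` into `{(0,1),(1,1)}`), each a two-bracket instance (`two_bracket`).
-/

namespace Summit.Ventures.PercRepro2.Tail2D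

/-- **absorption by two absorbers**: an outer pair of weight `PO ≤ P₁ + P₂` is paid for by two inner pairs
of weights `P₁`, `P₂` and coefficients `c₁, c₂ ≤ 0` as soon as `cO + c₁ ≤ 0` and `cO + c₂ ≤ 0`. -/
lemma absorb_two {PO P1 P2 cO c1 c2 : ℝ} (hPO : 0 ≤ PO) (hP1 : 0 ≤ P1) (hP2 : 0 ≤ P2)
    (hP : PO ≤ P1 + P2) (hc1 : c1 ≤ 0) (hc2 : c2 ≤ 0) (h1 : cO + c1 ≤ 0) (h2 : cO + c2 ≤ 0) :
    PO * cO + P1 * c1 + P2 * c2 ≤ 0 := by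
  rcases le_or_gt cO 0 with h | h
  · nlinarith [mul_nonneg hPO (neg_nonneg.2 h), mul_nonneg hP1 (neg_nonneg.2 hc1),
      mul_nonneg hP2 (neg_nonneg.2 hc2)]
  rcases le_or_gt PO P1 with hle | hgt
  · nlinarith [mul_le_mul_of_nonneg_right hle h.le, mul_nonneg hP1 (neg_nonneg.2 h1),
      mul_nonneg hP2 (neg_nonneg.2 hc2)]
  · have hμ : PO - P1 ≤ P2 := by linarith
    nlinarith [mul_nonneg hP1 (neg_nonneg.2 h1), mul_le_mul_of_nonneg_right hμ h.le,
      mul_nonneg hP2 (neg_nonneg.2 h2)]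

/-- **absorption by a pair and a couple**: an outer pair of weight `PO ≤ PI + min(P₂, P₃)` is paid for by
an inner pair `PI` with `cO + cI ≤ 0` and by a couple of inner pairs `P₂, P₃` with the three-term lemma
`cO + c₂ + c₃ ≤ 0` (all inner coefficients `≤ 0`). -/
lemma absorb_split {PO PI P2 P3 cO cI c2 c3 : ℝ} (hPO : 0 ≤ PO) (hPI : 0 ≤ PI) (hP2 : 0 ≤ P2)
    (hP3 : 0 ≤ P3) (hPa : PO ≤ PI + P2) (hPb : PO ≤ PI + P3) (hcI : cI ≤ 0) (hc2 : c2 ≤ 0)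
    (hc3 : c3 ≤ 0) (h1 : cO + cI ≤ 0) (h23 : cO + c2 + c3 ≤ 0) :
    PO * cO + PI * cI + P2 * c2 + P3 * c3 ≤ 0 := by
  rcases le_or_gt cO 0 with h | h
  · nlinarith [mul_nonneg hPO (neg_nonneg.2 h), mul_nonneg hPI (neg_nonneg.2 hcI),
      mul_nonneg hP2 (neg_nonneg.2 hc2), mul_nonneg hP3 (neg_nonneg.2 hc3)]
  rcases le_or_gt PO PI with hle | hgt
  · nlinarith [mul_le_mul_of_nonneg_right hle h.le, mul_nonneg hPI (neg_nonneg.2 h1),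
      mul_nonneg hP2 (neg_nonneg.2 hc2), mul_nonneg hP3 (neg_nonneg.2 hc3)]
  · have hμ2 : PO - PI ≤ P2 := by linarith
    have hμ3 : PO - PI ≤ P3 := by linarith
    nlinarith [mul_nonneg hPI (neg_nonneg.2 h1), mul_nonneg (sub_nonneg.2 hgt.le) (neg_nonneg.2 h23),
      mul_le_mul_of_nonneg_right hμ2 (neg_nonneg.2 hc2), mul_le_mul_of_nonneg_right hμ3 (neg_nonneg.2 hc3)]

/-- **the normalised core of the three-term lemma**: for `α ≥ α′ ≥ 1`, `β ≥ β′ ≥ 1`, `Y ≤ p ≤ 1`,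
`X ≤ q ≤ 1` and `X, Y ≥ 0`,
`(1 − X)(1 − Y) ≤ α(1 − p) + β(1 − q) + α′(pq − X) + β′(pq − Y)` — the right side minus the left is
`(α−α′)(1−p) + (β−β′)(1−q) + (α′−1)((1−p)(1−q) + (q−X)) + (β′−1)((1−p)(1−q) + (p−Y)) + (pq − XY) + (1−p)(1−q)`,
a sum of six non-negative products. -/
lemma t3_core {α α' β β' p q X Y : ℝ} (hα : α' ≤ α) (hα1 : 1 ≤ α') (hβ : β' ≤ β) (hβ1 : 1 ≤ β')
    (hp1 : p ≤ 1) (hpY : Y ≤ p) (hq1 : q ≤ 1) (hqX : X ≤ q) (hX : 0 ≤ X) (hY : 0 ≤ Y) :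
    (1 - X) * (1 - Y) ≤ α * (1 - p) + β * (1 - q) + α' * (p * q - X) + β' * (p * q - Y) := by
  have t1 := mul_nonneg (sub_nonneg.2 hα) (sub_nonneg.2 hp1)
  have t2 := mul_nonneg (sub_nonneg.2 hβ) (sub_nonneg.2 hq1)
  have s1 : 0 ≤ (1 - p) * (1 - q) := mul_nonneg (sub_nonneg.2 hp1) (sub_nonneg.2 hq1)
  have t3 := mul_nonneg (sub_nonneg.2 hα1) (add_nonneg s1 (sub_nonneg.2 hqX))
  have t4 := mul_nonneg (sub_nonneg.2 hβ1) (add_nonneg s1 (sub_nonneg.2 hpY))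
  have t5 : X * Y ≤ p * q := by nlinarith [mul_le_mul hqX hpY hY (le_trans hX hqX)]
  linarith [t1, t2, t3, t4, t5, s1]

/-- **L3, the algebraic form**: the thirteen tail values around a base point `z` with `m = T(z) > 0`
(`A, A′, A″` the row through `z` at `+1, −1, −2`; `B, B′, B″` the column; `u = T(z−e₁+e₂)`,
`v = T(z+e₁−e₂)`, `x = T(z−2e₁+e₂)`, `y = T(z+e₁−2e₂)`, `P = T(z+e₁+e₂)`, `Q = T(z−e₁−e₂)`) satisfy
`c(O) + c(I₂) + c(I₃) ≤ 0` as soon as six `m1` instances, two cone instances, the row / column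
log-concavity at `z − e₁`, `z − e₂` and the monotonicity hold.  Proof: with `X = AA′/m²`,
`Y = BB′/m²`, `p = uB′/(A′m) ∈ [Y, 1]`, `q = vA′/(B′m) ∈ [X, 1]`, `α = A′/m ≥ α′ = A″/A′ ≥ 1`,
`β = B′/m ≥ β′ = B″/B′ ≥ 1`: `c(O) ≤ m²(1−X)(1−Y)` (the product of the two `m1` instances at `z` and
`z − e₁ − e₂`), `−c(I₂) ≥ m²(α(1−p) + α′(pq − X))` (the `m1` instance at `z − 2e₁`),
`−c(I₃) ≥ m²(β(1−q) + β′(pq − Y))` (the `m1` instance at `z − 2e₂`), and `t3_core`. -/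
lemma t3_alg {m A A' A'' B B' B'' u v x y P Q : ℝ} (hm : 0 < m) (hA : 0 ≤ A) (hA' : 0 ≤ A')
    (hB : 0 ≤ B) (hB' : 0 ≤ B') (hu : 0 ≤ u) (hv : 0 ≤ v) (hQ : 0 ≤ Q)
    (h1 : m ≤ A') (h2 : A' ≤ A'') (h3 : m ≤ B') (h4 : B' ≤ B'')
    (h6 : m * A'' ≤ A' * A') (h8 : m * B'' ≤ B' * B')
    (h9 : A' * B ≤ u * m) (h10 : u * B' ≤ A' * m) (h11 : A * B' ≤ v * m) (h12 : v * A' ≤ B' * m)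
    (hPm : P * m ≤ A * B) (hQm : m * Q ≤ B' * A') (hF2 : u * A'' ≤ A' * x) (hF3 : v * B'' ≤ y * B') :
    (P * Q + m * m - A * A' - B * B') + (A * A'' + u * B' - v * x - A' * m)
      + (v * A' + B * B'' - y * u - m * B') ≤ 0 := by
  have hA'p : 0 < A' := lt_of_lt_of_le hm h1
  have hB'p : 0 < B' := lt_of_lt_of_le hm h3
  -- the normalised variables
  set α := A' / m with hαd
  set α' := A'' / A' with hα'd
  set β := B' / m with hβd
  set β' := B'' / B' with hβ'd
  set p := u * B' / (A' * m) with hpd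
  set q := v * A' / (B' * m) with hqd
  set X := A * A' / (m * m) with hXd
  set Y := B * B' / (m * m) with hYd
  have hmm : 0 < m * m := mul_pos hm hm
  have hA'm : 0 < A' * m := mul_pos hA'p hm
  have hB'm : 0 < B' * m := mul_pos hB'p hm
  have hα : α' ≤ α := by
    rw [hαd, hα'd, div_le_div_iff₀ hA'p hm]; linarith [h6]
  have hα1 : 1 ≤ α' := by rw [hα'd, le_div_iff₀ hA'p]; linarith
  have hβ : β' ≤ β := by
    rw [hβd, hβ'd, div_le_div_iff₀ hB'p hm]; linarith [h8]
  have hβ1 : 1 ≤ β' := by rw [hβ'd, le_div_iff₀ hB'p]; linarith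
  have hp1 : p ≤ 1 := by rw [hpd, div_le_one hA'm]; exact h10
  have hq1 : q ≤ 1 := by rw [hqd, div_le_one hB'm]; exact h12
  have hpY : Y ≤ p := by
    rw [hpd, hYd, div_le_div_iff₀ hmm hA'm]
    have := mul_le_mul_of_nonneg_right h9 (mul_nonneg hB' hm.le); linarith [this]
  have hqX : X ≤ q := by
    rw [hqd, hXd, div_le_div_iff₀ hmm hB'm]
    have := mul_le_mul_of_nonneg_right h11 (mul_nonneg hA' hm.le); linarith [this]
  have hX : 0 ≤ X := by rw [hXd]; positivity
  have hY : 0 ≤ Y := by rw [hYd]; positivity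
  have core := t3_core hα hα1 hβ hβ1 hp1 hpY hq1 hqX hX hY
  -- translate back: m² (1 − X)(1 − Y) = (m² − A A′)(m² − B B′) / m², etc.
  have e1 : m * m * ((1 - X) * (1 - Y)) = (m * m - A * A') * (m * m - B * B') / (m * m) := by
    rw [hXd, hYd]; field_simp
  have e2 : m * m * (α * (1 - p) + α' * (p * q - X)) = (A' * A' * m - A' * u * B' + A'' * u * v - A' * A * A'') / A' := by
    rw [hαd, hα'd, hpd, hqd, hXd]; field_simp; ring
  have e3 : m * m * (β * (1 - q) + β' * (p * q - Y)) = (B' * B' * m - B' * v * A' + B'' * u * v - B' * B * B'') / B' := by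
    rw [hβd, hβ'd, hpd, hqd, hYd]; field_simp; ring
  have key : m * m * ((1 - X) * (1 - Y)) ≤ m * m * (α * (1 - p) + α' * (p * q - X)) + m * m * (β * (1 - q) + β' * (p * q - Y)) := by
    have := mul_le_mul_of_nonneg_left core hmm.le; linarith [this]
  rw [e1, e2, e3] at key
  -- (a): m² c(O) ≤ (m² − A A′)(m² − B B′)
  have ha : (P * Q + m * m - A * A' - B * B') ≤ (m * m - A * A') * (m * m - B * B') / (m * m) := by
    rw [le_div_iff₀ hmm]
    have := mul_le_mul hPm hQm (mul_nonneg hm.le hQ) (mul_nonneg hA hB)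
    linarith [this]
  -- (b): A′ (−c₂) ≥ …
  have hb : (A' * A' * m - A' * u * B' + A'' * u * v - A' * A * A'') / A' ≤ -(A * A'' + u * B' - v * x - A' * m) := by
    rw [div_le_iff₀ hA'p]
    have := mul_le_mul_of_nonneg_left hF2 hv; linarith [this]
  have hc : (B' * B' * m - B' * v * A' + B'' * u * v - B' * B * B'') / B' ≤ -(v * A' + B * B'' - y * u - m * B') := by
    rw [div_le_iff₀ hB'p]
    have := mul_le_mul_of_nonneg_left hF3 hu; linarith [this]
  linarith [key, ha, hb, hc]

namespace IsMTail

variable {T : ℤ → ℤ → ℝ} {L : ℤ} (hT : IsMTail T L)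

include hT

/-- the two-step `e₂`-ratio `T(x, b+1)/T(x, b-1)` is non-increasing along `e₁`:
`T(a, b+1)·T(a-1, b-1) ≤ T(a-1, b+1)·T(a, b-1)` -/
lemma d2two_e1 (a b : ℤ) : T a (b + 1) * T (a - 1) (b - 1) ≤ T (a - 1) (b + 1) * T a (b - 1) := by
  have s1 := hT.d2_quad (a := a - 1) (b := b - 1) (a' := a) (b' := b - 1) (by omega) le_rfl
  rw [show b - 1 + 1 = b by ring] at s1
  -- s1 : T a b * T (a-1) (b-1) ≤ T (a-1) b * T a (b-1)
  have s2 := hT.d2_quad (a := a - 1) (b := b) (a' := a) (b' := b) (by omega) le_rfl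
  -- s2 : T a (b+1) * T (a-1) b ≤ T (a-1) (b+1) * T a b
  have hz : T (a - 1) b * T a b = 0 → T a (b + 1) * T (a - 1) (b - 1) ≤ T (a - 1) (b + 1) * T a (b - 1) := by
    intro h
    have hP : T a (b + 1) = 0 := by
      rcases mul_eq_zero.mp h with h | h
      · have h1 := hT.anti₁_of_le (a := a - 1) (a' := a) (by omega) (b + 1)
        have h2 := hT.anti₂ (a - 1) b
        rw [h] at h2
        exact le_antisymm (le_trans h1 h2) (hT.nonneg _ _)
      · exact le_antisymm (h ▸ hT.anti₂ a b) (hT.nonneg _ _)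
    rw [hP, zero_mul]; exact mul_nonneg (hT.nonneg _ _) (hT.nonneg _ _)
  exact chain' (P := T a (b + 1)) (Q := T (a - 1) (b - 1)) (R := T (a - 1) (b + 1)) (S := T a (b - 1))
    (M := T (a - 1) b) (N := T a b) (hT.nonneg _ _) (hT.nonneg _ _) (hT.nonneg _ _) (hT.nonneg _ _)
    hz s1 s2

/-- the mirror: the two-step `e₁`-ratio `T(a+1, y)/T(a-1, y)` is non-increasing along `e₂`:
`T(a+1, b)·T(a-1, b-1) ≤ T(a+1, b-1)·T(a-1, b)` -/
lemma d1two_e2 (a b : ℤ) : T (a + 1) b * T (a - 1) (b - 1) ≤ T (a + 1) (b - 1) * T (a - 1) b := by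
  have s1 := hT.d1_quad (a := a - 1) (b := b - 1) (a' := a - 1) (b' := b) le_rfl (by omega)
  rw [show a - 1 + 1 = a by ring] at s1
  -- s1 : T a b * T (a-1) (b-1) ≤ T a (b-1) * T (a-1) b
  have s2 := hT.d1_quad (a := a) (b := b - 1) (a' := a) (b' := b) le_rfl (by omega)
  -- s2 : T (a+1) b * T a (b-1) ≤ T (a+1) (b-1) * T a b
  have hz : T a (b - 1) * T a b = 0 → T (a + 1) b * T (a - 1) (b - 1) ≤ T (a + 1) (b - 1) * T (a - 1) b := by
    intro h
    have hP : T (a + 1) b = 0 := by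
      rcases mul_eq_zero.mp h with h | h
      · have h1 := hT.anti₂_of_le (a + 1) (b := b - 1) (b' := b) (by omega)
        have h2 := hT.anti₁ a (b - 1)
        rw [h] at h2
        exact le_antisymm (le_trans h1 h2) (hT.nonneg _ _)
      · exact le_antisymm (h ▸ hT.anti₁ a b) (hT.nonneg _ _)
    rw [hP, zero_mul]; exact mul_nonneg (hT.nonneg _ _) (hT.nonneg _ _)
  exact chain' (P := T (a + 1) b) (Q := T (a - 1) (b - 1)) (R := T (a + 1) (b - 1)) (S := T (a - 1) b)
    (M := T a (b - 1)) (N := T a b) (hT.nonneg _ _) (hT.nonneg _ _) (hT.nonneg _ _) (hT.nonneg _ _)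
    hz s1 s2

/-- **N1**: the `m1` pair `{(2,0),(0,0)}` absorbed into `{(1,0),(1,1)}` — a signed `e₂`-exchange along
`3e₁` plus a two-bracket instance whose cross condition is `m1` at `(a-1, b-1)` -/
lemma abs1_N1 (a b : ℤ) :
    crossB1 T (a - 2) b a b + crossB1 T a b (a - 2) b
      + crossB1 T (a - 1) b (a - 1) (b - 1) + crossB1 T (a - 1) (b - 1) (a - 1) b ≤ 0 := by
  unfold crossB1
  -- β₁ : T(a+1,b+1)·T(a-2,b) ≤ T(a-2,b+1)·T(a+1,b)
  have β₁ := hT.d2_cone (a := a - 2) (b := b) (a' := a + 1) (b' := b) le_rfl (by omega)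
  -- the two-bracket instance
  have hab := hT.d2two_e1 a b
  have hcb : T (a - 1) (b + 1) * T a b ≤ T (a - 1) (b + 1) * T a (b - 1) :=
    mul_le_mul_of_nonneg_left (hT.anti₂_of_le a (b := b - 1) (b' := b) (by omega)) (hT.nonneg _ _)
  have hm1 := hT.m1 (a - 1) (b - 1)
  rw [show a - 1 + 1 = a by ring, show b - 1 + 1 = b by ring] at hm1
  -- hm1 : T a b * T (a-1) (b-1) ≤ T a (b-1) * T (a-1) b
  have hacbd : (T a (b + 1) * T (a - 1) (b - 1)) * (T (a - 1) (b + 1) * T a b)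
      ≤ (T (a - 1) (b + 1) * T a (b - 1)) * (T (a - 1) b * T a (b + 1)) := by
    have := mul_le_mul_of_nonneg_left hm1 (mul_nonneg (hT.nonneg a (b + 1)) (hT.nonneg (a - 1) (b + 1)))
    nlinarith [this]
  have tb := two_bracket (a := T a (b + 1) * T (a - 1) (b - 1)) (b := T (a - 1) (b + 1) * T a (b - 1))
    (c := T (a - 1) (b + 1) * T a b) (d := T (a - 1) b * T a (b + 1))
    (mul_nonneg (hT.nonneg _ _) (hT.nonneg _ _)) (mul_nonneg (hT.nonneg _ _) (hT.nonneg _ _))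
    (mul_nonneg (hT.nonneg _ _) (hT.nonneg _ _)) hab hcb hacbd
  ring_nf at β₁ tb ⊢
  linarith [β₁, tb]

/-- **N1′** (the mirror): the `m1` pair `{(0,2),(0,0)}` absorbed into `{(0,1),(1,1)}` -/
lemma abs1_N1' (a b : ℤ) :
    crossB1 T a (b - 2) a b + crossB1 T a b a (b - 2)
      + crossB1 T a (b - 1) (a - 1) (b - 1) + crossB1 T (a - 1) (b - 1) a (b - 1) ≤ 0 := by
  unfold crossB1
  -- β₁ : T(a+1,b+1)·T(a,b-2) ≤ T(a+1,b-2)·T(a,b+1)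
  have β₁ := hT.d1_cone (a := a) (b := b - 2) (a' := a) (b' := b + 1) le_rfl (by omega)
  have hab := hT.d1two_e2 a b
  have hcb : T (a + 1) (b - 1) * T a b ≤ T (a + 1) (b - 1) * T (a - 1) b :=
    mul_le_mul_of_nonneg_left (hT.anti₁_of_le (a := a - 1) (a' := a) (by omega) b) (hT.nonneg _ _)
  have hm1 := hT.m1 (a - 1) (b - 1)
  rw [show a - 1 + 1 = a by ring, show b - 1 + 1 = b by ring] at hm1
  have hacbd : (T (a + 1) b * T (a - 1) (b - 1)) * (T (a + 1) (b - 1) * T a b)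
      ≤ (T (a + 1) (b - 1) * T (a - 1) b) * (T a (b - 1) * T (a + 1) b) := by
    have := mul_le_mul_of_nonneg_left hm1 (mul_nonneg (hT.nonneg (a + 1) b) (hT.nonneg (a + 1) (b - 1)))
    nlinarith [this]
  have tb := two_bracket (a := T (a + 1) b * T (a - 1) (b - 1)) (b := T (a + 1) (b - 1) * T (a - 1) b)
    (c := T (a + 1) (b - 1) * T a b) (d := T a (b - 1) * T (a + 1) b)
    (mul_nonneg (hT.nonneg _ _) (hT.nonneg _ _)) (mul_nonneg (hT.nonneg _ _) (hT.nonneg _ _))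
    (mul_nonneg (hT.nonneg _ _) (hT.nonneg _ _)) hab hcb hacbd
  ring_nf at β₁ tb ⊢
  linarith [β₁, tb]

/-- **N2b**: the `m2` pair `{(2,0),(0,0)}` absorbed into `{(1,0),(2,0)}` — a signed `w`-exchange plus a
two-bracket instance whose cross condition is a `w`-exchange along `e₁` -/
lemma abs2_N2b (a b : ℤ) :
    crossB T (a - 2) b a b + crossB T a b (a - 2) b
      + crossB T (a - 1) b (a - 2) b + crossB T (a - 2) b (a - 1) b ≤ 0 := by
  unfold crossB
  -- A : T(a+2,b-1)·T(a-2,b) ≤ T(a-1,b-1)·T(a+1,b)   (dw_cone from (a-2,b) to (a+1,b))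
  have hA := hT.dw_cone (a := a - 2) (b := b) (a' := a + 1) (b' := b) (by omega) le_rfl
  rw [show a - 2 + 1 = a - 1 by ring, show a + 1 + 1 = a + 2 by ring] at hA
  -- the signed bracket of the two-bracket instance: T(a+1,b-1)·T(a-2,b) ≤ T(a-1,b-1)·T(a,b)
  have hab := hT.dw_cone (a := a - 2) (b := b) (a' := a) (b' := b) (by omega) le_rfl
  rw [show a - 2 + 1 = a - 1 by ring, mul_comm (T (a - 1) (b - 1)) (T a b)] at hab
  -- c ≤ b : T(a,b-1)·T(a,b) ≤ T(a,b)·T(a-1,b-1)  (T(a,b-1) ≤ T(a-1,b-1))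
  have hcb : T a (b - 1) * T a b ≤ T a b * T (a - 1) (b - 1) := by
    have := mul_le_mul_of_nonneg_left (hT.anti₁_of_le (a := a - 1) (a' := a) (by omega) (b - 1)) (hT.nonneg a b)
    linarith [this, mul_comm (T a b) (T a (b - 1))]
  -- the cross condition: T(a-2,b)·T(a,b-1) ≤ T(a-1,b-1)·T(a-1,b)  (dw_cone from (a-2,b) to (a-1,b))
  have hw := hT.dw_cone (a := a - 2) (b := b) (a' := a - 1) (b' := b) (by omega) le_rfl
  rw [show a - 1 + 1 = a by ring, show a - 2 + 1 = a - 1 by ring] at hw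
  -- hw : T a (b-1) * T (a-2) b ≤ T (a-1) (b-1) * T (a-1) b
  have hacbd : (T (a + 1) (b - 1) * T (a - 2) b) * (T a (b - 1) * T a b)
      ≤ (T a b * T (a - 1) (b - 1)) * (T (a - 1) b * T (a + 1) (b - 1)) := by
    have := mul_le_mul_of_nonneg_left hw (mul_nonneg (hT.nonneg (a + 1) (b - 1)) (hT.nonneg a b))
    nlinarith [this]
  have tb := two_bracket (a := T (a + 1) (b - 1) * T (a - 2) b) (b := T a b * T (a - 1) (b - 1))
    (c := T a (b - 1) * T a b) (d := T (a - 1) b * T (a + 1) (b - 1))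
    (mul_nonneg (hT.nonneg _ _) (hT.nonneg _ _)) (mul_nonneg (hT.nonneg _ _) (hT.nonneg _ _))
    (mul_nonneg (hT.nonneg _ _) (hT.nonneg _ _)) hab hcb hacbd
  ring_nf at hA tb ⊢
  linarith [hA, tb]

/-- **L3** (the three-term lemma): the `m1` pair `{(1,1),(0,0)}` absorbed into the couple
`{(0,1),(2,0)}`, `{(0,2),(1,0)}`: `c(O) + c(I₂) + c(I₃) ≤ 0` for every M♮-concave tail at every base
point.  Proof: if `T(z) = 0` everything to the upper right vanishes and `c(O) = 0`; otherwise `t3_alg`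
with the thirteen tail values around `z` (six `m1` instances, two cone instances, row / column
log-concavity, monotonicity). -/
lemma abs1_T3 (a b : ℤ) :
    crossB1 T (a - 1) (b - 1) a b + crossB1 T a b (a - 1) (b - 1)
      + (crossB1 T a (b - 1) (a - 2) b + crossB1 T (a - 2) b a (b - 1))
      + (crossB1 T a (b - 2) (a - 1) b + crossB1 T (a - 1) b a (b - 2)) ≤ 0 := by
  unfold crossB1
  rw [show a - 1 + 1 = a by ring, show b - 1 + 1 = b by ring, show a - 2 + 1 = a - 1 by ring,
    show b - 2 + 1 = b - 1 by ring]
  rcases (hT.nonneg a b).lt_or_eq with hm | hm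
  · -- the generic case
    have h1 := hT.anti₁ (a - 1) b
    rw [show a - 1 + 1 = a by ring] at h1
    have h2 := hT.anti₁ (a - 2) b
    rw [show a - 2 + 1 = a - 1 by ring] at h2
    have h3 := hT.anti₂ a (b - 1)
    rw [show b - 1 + 1 = b by ring] at h3
    have h4 := hT.anti₂ a (b - 2)
    rw [show b - 2 + 1 = b - 1 by ring] at h4
    have h6 := hT.row (a - 2) b
    rw [show a - 2 + 2 = a by ring, show a - 2 + 1 = a - 1 by ring] at h6
    have h8 := hT.col a (b - 2)
    rw [show b - 2 + 2 = b by ring, show b - 2 + 1 = b - 1 by ring] at h8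
    have h9 := hT.m1 (a - 1) b
    rw [show a - 1 + 1 = a by ring] at h9
    have h10 := hT.d2_cone (a := a) (b := b - 1) (a' := a - 1) (b' := b) (by omega) (by omega)
    rw [show b - 1 + 1 = b by ring] at h10
    have h11 := hT.m1 a (b - 1)
    rw [show b - 1 + 1 = b by ring] at h11
    have h12 := hT.d1_cone (a := a - 1) (b := b) (a' := a) (b' := b - 1) (by omega) (by omega)
    rw [show a - 1 + 1 = a by ring] at h12
    have hPm := hT.m1 a b
    have hQm := hT.m1 (a - 1) (b - 1)
    rw [show a - 1 + 1 = a by ring, show b - 1 + 1 = b by ring] at hQm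
    have hF2 := hT.m1 (a - 2) b
    rw [show a - 2 + 1 = a - 1 by ring] at hF2
    have hF3 := hT.m1 a (b - 2)
    rw [show b - 2 + 1 = b - 1 by ring] at hF3
    have key := t3_alg (m := T a b) (A := T (a + 1) b) (A' := T (a - 1) b) (A'' := T (a - 2) b)
      (B := T a (b + 1)) (B' := T a (b - 1)) (B'' := T a (b - 2)) (u := T (a - 1) (b + 1))
      (v := T (a + 1) (b - 1)) (x := T (a - 2) (b + 1)) (y := T (a + 1) (b - 2)) (P := T (a + 1) (b + 1))
      (Q := T (a - 1) (b - 1)) hm (hT.nonneg _ _) (hT.nonneg _ _) (hT.nonneg _ _) (hT.nonneg _ _)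
      (hT.nonneg _ _) (hT.nonneg _ _) (hT.nonneg _ _) h1 h2 h3 h4 (by linarith [h6])
      (by linarith [h8]) (by linarith [h9]) (by linarith [h10]) (by linarith [h11]) (by linarith [h12])
      (by linarith [hPm]) (by linarith [hQm]) (by linarith [hF2]) (by linarith [hF3])
    linarith [key]
  · -- T(z) = 0: then T(z + e₁) = T(z + e₂) = T(z + e₁ + e₂) = 0 and the sum is
    -- `−T(a+1,b−1)·T(a−2,b+1) − T(a+1,b−2)·T(a−1,b+1) + …` — every remaining term is ≤ 0
    have hA : T (a + 1) b = 0 := le_antisymm (hm ▸ hT.anti₁ a b) (hT.nonneg _ _)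
    have hB : T a (b + 1) = 0 := le_antisymm (hm ▸ hT.anti₂ a b) (hT.nonneg _ _)
    have hP : T (a + 1) (b + 1) = 0 := le_antisymm (hB ▸ hT.anti₁ a (b + 1)) (hT.nonneg _ _)
    rw [← hm, hA, hB, hP]
    have n1 := mul_nonneg (hT.nonneg (a + 1) (b - 1)) (hT.nonneg (a - 2) (b + 1))
    have n2 := mul_nonneg (hT.nonneg (a + 1) (b - 2)) (hT.nonneg (a - 1) (b + 1))
    have n3 := mul_nonneg (hT.nonneg (a - 1) (b + 1)) (hT.nonneg a (b - 1))
    have n4 := mul_nonneg (hT.nonneg (a + 1) (b - 1)) (hT.nonneg (a - 1) b)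
    -- with T(a,b) = 0 the positive terms u·B′ and v·A′ must be controlled: u B′ ≤ A′ m = 0
    have h10 := hT.d2_cone (a := a) (b := b - 1) (a' := a - 1) (b' := b) (by omega) (by omega)
    rw [show b - 1 + 1 = b by ring, ← hm] at h10
    have h12 := hT.d1_cone (a := a - 1) (b := b) (a' := a) (b' := b - 1) (by omega) (by omega)
    rw [show a - 1 + 1 = a by ring, ← hm] at h12
    nlinarith [n1, n2, n3, n4, h10, h12]

end IsMTail

end Summit.Ventures.PercRepro2.Tail2D
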